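import Mathlib.LinearAlgebra.Eigenspace.Semisimple
import Mathlib.LinearAlgebra.Eigenspace.Minpoly
import Mathlib.LinearAlgebra.Eigenspace.Triangularizable
import Mathlib.LinearAlgebra.Semisimple
import Mathlib.FieldTheory.IsAlgClosed.Basic
import Mathlib.RingTheory.Polynomial.Tower
import Literature.AlgebraicGeometry.Motives.MumfordTateInvariantsBaseChange
import HarnessLib

/-!
# Semisimple endomorphisms: complex eigenbases and eigenvalue weights (Mumford–Tate invariants, step 9)

For a SEMISIMPLE `X ∈ End_ℚ V` (`V` finite-dimensional) the complexification `X_ℂ` is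
diagonalisable: `exists_eigenbasis_of_isSemisimple` gives a basis `b` of `V_ℂ` of eigenvectors,
with eigenvalues `ev i` among the complex roots of the minimal polynomial `minpoly ℚ X`
(Borel, *Linear Algebraic Groups*, §4.1–4.2: semisimple = diagonalisable over the algebraic
closure). In the tensor basis `hodgeTensorBasis b a b` the derivation action `ρ(X_ℂ)` is then
diagonal with eigenvalue `Σₖ ev (β k) - Σₗ ev (γ l)` and a polynomial `P₀(X)_ℂ` acts diagonally
with eigenvalue `∏ₖ P₀(ev (β k)) (∏ₗ P₀(ev (γ l)))⁻¹`. Both are governed by the integer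
**weight vector** of the index `x = (β, γ)` on the roots,
`tensorWeight ev x μ = #{k | ev (β k) = μ} - #{l | ev (γ l) = μ}`:
`Σ_μ tensorWeight x μ • μ = Σ ev β - Σ ev γ` (`sum_tensorWeight_smul`) and
`∏_μ U(μ) ^ tensorWeight x μ = ∏ U(ev β) (∏ U(ev γ))⁻¹` (`prod_zpow_tensorWeight`). This is the
dictionary between the additive relations among eigenvalues of `X` and the multiplicative
relations among eigenvalues of elements of the torus through `X` (Borel, op. cit., §8.2,
characters of a torus) used to place the rational torus points of
`MumfordTateInvariantsTorusPoints.lean` inside the Mumford–Tate group.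

## References

* A. Borel, *Linear Algebraic Groups*, 2nd ed., GTM 126 (1991), §4.1–4.2, §8.2.
-/

noncomputable section

open scoped TensorProduct
open Polynomial

namespace Literature.AlgebraicGeometry.Motives

universe u v w

/-! ### Weight vectors of tensor indices -/

section Weights

variable {ι : Type v} {R : Type w} [Fintype R] [DecidableEq R]

/-- The **weight vector** of a tensor index `x = (β, γ)` with respect to an eigenvalue map `ev`:
`μ ↦ #{k | ev (β k) = μ} - #{l | ev (γ l) = μ}` (the character of the diagonal torus through which
it acts on the tensor basis vector indexed by `x`; Borel, *Linear Algebraic Groups*, §8.2). [folklore] -/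
def tensorWeight (ev : ι → R) {a b : ℕ} (x : (Fin a → ι) × (Fin b → ι)) (μ : R) : ℤ :=
  ((Finset.univ.filter fun k => ev (x.1 k) = μ).card : ℤ) -
    ((Finset.univ.filter fun l => ev (x.2 l) = μ).card : ℤ)

/-- **Additive dictionary**: `Σ_μ w_x(μ) • f μ = Σₖ f (ev (β k)) - Σₗ f (ev (γ l))`. [folklore] -/
theorem sum_tensorWeight_smul {A : Type u} [AddCommGroup A] (ev : ι → R) {a b : ℕ}
    (x : (Fin a → ι) × (Fin b → ι)) (f : R → A) :
    ∑ μ, tensorWeight ev x μ • f μ = (∑ k, f (ev (x.1 k))) - ∑ l, f (ev (x.2 l)) := by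
  simp only [tensorWeight, sub_smul, Finset.sum_sub_distrib, natCast_zsmul]
  congr 1
  · rw [← Finset.sum_fiberwise Finset.univ (fun k => ev (x.1 k)) fun k => f (ev (x.1 k))]
    refine Finset.sum_congr rfl fun μ _ => ?_
    rw [Finset.sum_congr rfl (g := fun _ => f μ) fun k hk => by rw [(Finset.mem_filter.1 hk).2],
      Finset.sum_const]
  · rw [← Finset.sum_fiberwise Finset.univ (fun l => ev (x.2 l)) fun l => f (ev (x.2 l))]
    refine Finset.sum_congr rfl fun μ _ => ?_
    rw [Finset.sum_congr rfl (g := fun _ => f μ) fun l hl => by rw [(Finset.mem_filter.1 hl).2],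
      Finset.sum_const]

/-- **Multiplicative dictionary**: `∏_μ U(μ) ^ w_x(μ) = (∏ₖ U (ev (β k))) (∏ₗ U (ev (γ l)))⁻¹` for
non-vanishing `U`. [folklore] -/
theorem prod_zpow_tensorWeight {K : Type u} [Field K] (ev : ι → R) {a b : ℕ}
    (x : (Fin a → ι) × (Fin b → ι)) {U : R → K} (hU : ∀ μ, U μ ≠ 0) :
    ∏ μ, U μ ^ tensorWeight ev x μ = (∏ k, U (ev (x.1 k))) * (∏ l, U (ev (x.2 l)))⁻¹ := by
  simp only [tensorWeight, zpow_sub₀ (hU _), zpow_natCast, div_eq_mul_inv, Finset.prod_mul_distrib,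
    Finset.prod_inv_distrib]
  congr 1
  · rw [← Finset.prod_fiberwise Finset.univ (fun k => ev (x.1 k)) fun k => U (ev (x.1 k))]
    refine Finset.prod_congr rfl fun μ _ => ?_
    rw [Finset.prod_congr rfl (g := fun _ => U μ) fun k hk => by rw [(Finset.mem_filter.1 hk).2],
      Finset.prod_const]
  · congr 1
    rw [← Finset.prod_fiberwise Finset.univ (fun l => ev (x.2 l)) fun l => U (ev (x.2 l))]
    refine Finset.prod_congr rfl fun μ _ => ?_
    rw [Finset.prod_congr rfl (g := fun _ => U μ) fun l hl => by rw [(Finset.mem_filter.1 hl).2],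
      Finset.prod_const]

omit [Fintype R] in
/-- The difference of two weight vectors, pointwise. [folklore] -/
theorem tensorWeight_sub_apply (ev : ι → R) {a b : ℕ} (x x' : (Fin a → ι) × (Fin b → ι)) (μ : R) :
    tensorWeight ev x μ - tensorWeight ev x' μ = (tensorWeight ev x - tensorWeight ev x') μ :=
  rfl

end Weights

/-! ### Complex eigenbases of semisimple rational endomorphisms -/

section Eigenbasis

variable {V : Type u} [AddCommGroup V] [Module ℚ V] [Module.Finite ℚ V]

omit [Module.Finite ℚ V] in
/-- Base change commutes with evaluating rational polynomials: `(P(X))_ℂ = P(X_ℂ)`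
(`Module.End.baseChangeHom` is an algebra homomorphism). [folklore] -/
theorem baseChange_aeval (X : Module.End ℚ V) (P : ℚ[X]) :
    (aeval X P).baseChange ℂ = aeval (X.baseChange ℂ) (P.map (algebraMap ℚ ℂ)) := by
  rw [aeval_map_algebraMap]
  exact (aeval_algHom_apply (Module.End.baseChangeHom ℚ ℂ V) X P).symm

/-- The complexification of a semisimple rational endomorphism is semisimple (its minimal
polynomial over `ℚ` is separable, hence squarefree over `ℂ`). [folklore] -/
theorem isSemisimple_baseChange {X : Module.End ℚ V} (hX : X.IsSemisimple) :
    Module.End.IsSemisimple (X.baseChange ℂ : Module.End ℂ (ℂ ⊗[ℚ] V)) := by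
  have hsep : (minpoly ℚ X).Separable := PerfectField.separable_iff_squarefree.2 hX.minpoly_squarefree
  refine Module.End.isSemisimple_of_squarefree_aeval_eq_zero
    (p := (minpoly ℚ X).map (algebraMap ℚ ℂ)) (hsep.map (f := algebraMap ℚ ℂ)).squarefree ?_
  rw [← baseChange_aeval, minpoly.aeval, LinearMap.baseChange_zero]

/-- **Complex eigenbasis of a semisimple rational endomorphism.** For `X ∈ End_ℚ V` semisimple
there is a basis of `V_ℂ` of eigenvectors of `X_ℂ`, with eigenvalues among the complex roots of
`minpoly ℚ X` (Borel, *Linear Algebraic Groups*, §4.1–4.2: semisimple elements are diagonalisable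
over the algebraic closure). [folklore] -/
theorem exists_eigenbasis_of_isSemisimple {X : Module.End ℚ V} (hX : X.IsSemisimple) :
    ∃ (S : Type u) (_ : Fintype S) (b : Module.Basis S ℂ (ℂ ⊗[ℚ] V))
      (ev : S → (minpoly ℚ X).rootSet ℂ), ∀ i, X.baseChange ℂ (b i) = ((ev i : ℂ)) • b i := by
  classical
  set Xc : Module.End ℂ (ℂ ⊗[ℚ] V) := X.baseChange ℂ with hXc
  have hss : Xc.IsSemisimple := isSemisimple_baseChange hX
  have htop : ⨆ μ : ℂ, Xc.eigenspace μ = ⊤ := by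
    have h := Module.End.iSup_maxGenEigenspace_eq_top Xc
    simp_rw [hss.isFinitelySemisimple.maxGenEigenspace_eq_eigenspace] at h
    exact h
  have hind : iSupIndep fun μ : ℂ => Xc.eigenspace μ := Xc.eigenspaces_iSupIndep
  have hint : DirectSum.IsInternal fun μ : ℂ => Xc.eigenspace μ :=
    DirectSum.isInternal_submodule_of_iSupIndep_of_iSup_eq_top hind htop
  let κ : ℂ → Type u := fun μ => Module.Free.ChooseBasisIndex ℂ (Xc.eigenspace μ)
  let b : Module.Basis (Σ μ, κ μ) ℂ (ℂ ⊗[ℚ] V) :=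
    hint.collectedBasis fun μ => Module.Free.chooseBasis ℂ (Xc.eigenspace μ)
  haveI : Fintype (Σ μ, κ μ) := FiniteDimensional.fintypeBasisIndex b
  have hb_mem : ∀ σ : Σ μ, κ μ, b σ ∈ Xc.eigenspace σ.1 := fun σ => hint.collectedBasis_mem _ σ
  have hroot : ∀ σ : Σ μ, κ μ, σ.1 ∈ (minpoly ℚ X).rootSet ℂ := by
    intro σ
    have hev : Xc.HasEigenvalue σ.1 :=
      Module.End.hasEigenvalue_of_hasEigenvector ⟨hb_mem σ, b.ne_zero σ⟩
    have h1 : (minpoly ℂ Xc).IsRoot σ.1 := Module.End.isRoot_of_hasEigenvalue hev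
    have h0 : aeval Xc ((minpoly ℚ X).map (algebraMap ℚ ℂ)) = 0 := by
      rw [← baseChange_aeval, minpoly.aeval, LinearMap.baseChange_zero]
    have h2 : ((minpoly ℚ X).map (algebraMap ℚ ℂ)).IsRoot σ.1 := h1.dvd (minpoly.dvd ℂ Xc h0)
    rw [mem_rootSet, aeval_def, ← eval_map]
    exact ⟨minpoly.ne_zero (Algebra.IsIntegral.isIntegral X), h2⟩
  refine ⟨Σ μ, κ μ, inferInstance, b, fun σ => ⟨σ.1, hroot σ⟩, fun σ => ?_⟩
  exact Module.End.mem_eigenspace_iff.1 (hb_mem σ)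

end Eigenbasis

end Literature.AlgebraicGeometry.Motives

end
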